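/-
Origin: expansion seat `prover-pub-hodgecm-mc-sinst-1-g7-0`, handover #1230 2026-08-20T15:40Z md5 00c84f88f4a1 (243 l., 18 decls: 3 abbrevs + 15 theorems) NEW additive leaf, ns HodgeCM.Model.SInstance (+ .GRU); imports RUN-51 #1229 ThetaAdelicSideR2 only; drop-alone; the uniform-[GR91 3.1.1] pin R2 SROGT'CU / SROGT'CJU + derived families GRU.hGR…hGR₃; NAME LIST: HodgeCM.Model.SInstance.GRU.hGR · HodgeCM.Model.SInstance.SROGT'CJU_eq_SROGT'C · HodgeCM.Model.SInstance.SROGT'CJU_eq_archSideOfT' (`HOME/mc/pub-hodgecm-mc-sinst-1-g7/stage/HodgeCM/Model/ThetaAdelicSideR2U.lean`, md5 00c84f88f4a1, 243 lines);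
landed by the gen-22 packager (p-g22) in gate run 55 as `HodgeCM/Model/ThetaAdelicSideR2U.lean` (verbatim).
-/
/-
Origin: CONSTRUCTION seat `prover-pub-hodgecm-mc-sinst-1-g7-0` (unit pub-hodgecm-mc-sinst-1-g7, gen 7 of mc-sinst-1 — S-INSTANCE CONSTRUCTOR,
BINDER-OWNERS row 5 `S`), 2026-08-20.  KERNEL only: 3 abbrevs + theorems; closure {propext, Classical.choice, Quot.sound}.
Additive leaf over #1229 `ThetaAdelicSideR2` (RUN 51); nothing of PerL ∕ QW8 is claimed; 0 records, 0 `def … : Prop`, nothing cited anew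
(the ONE named fact involved, `SplittingDatum.CompatibleSplitting` = [GelbartRogawski1991, Prop. 3.1.1], is the Vendored record already
consumed by #1228 ∕ #1229; here it is only INSTANTIATED, through ONE uniformly quantified hypothesis instead of five).
-/
import Summits.HodgeConjecture.HodgeCM.Model.ThetaAdelicSideR2

/-!
# (GR-U) R2, S SIDE: the row-5 pin R2 over ONE UNIFORM [GR91 Prop. 3.1.1] hypothesis — `SInstance.SROGT'CU` / `SROGT'CJU`

The pins of record `SROGT'C` / `SROGT'CJ` (#1229) — and every E-shaped leaf over them (glue-1 #398J2W ≺ … ≺ #398J2HHTC ≺ #398J2HHTCG,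
«9 groups `hA hGR hGR₀ hGR₁ hGR₂ hGR₃ μ hR hΘ`») — display the cited proposition [GelbartRogawski1991, §3.1 Prop. 3.1.1, p. 455 L1–3]
FIVE times, as the (V, c)-indexed families

  `hGR`  at `cmSplittingDatum L finProdFinEquiv (frameD V) … (dW c.D) …`            (the 3 × 2 block, `G₁ = U(diag(frameD V) ⊗ diag(a₀,a₁))`),
  `hGR₀` ∕ `hGR₁` at `cmSplittingDatum L e₁ (frameD V) … (lineVec L (dW c.D 0 ∕ 1)) …`   (the 3 × 1 lines of the first plane),
  `hGR₂` ∕ `hGR₃` at `cmSplittingDatum L e₁ (frameD V) … (lineVec L (dW' c.D 0 ∕ 1)) …`  (the 3 × 1 lines of the second plane).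

The printed proposition is ONE statement, universally quantified over its skew-Hermitian space («Let `(V, Φ)` be a skew Hermitian space,
where `V` is an `n`-dimensional vector space over `E` … **Proposition 3.1.1.** The covering `π` splits over `G(𝐀)`. There exists a
continuous section `s : G(𝐀) → Mp_𝐀(W)` such that `s(G(F))` is contained in `i(Sp_F(W))`», pp. 454–455), and the Vendored record
`SplittingDatum.CompatibleSplitting` is that statement as a predicate on an abstract datum, to be instantiated at the CONSTRUCTED data
`cmSplittingDatum L e dV … dW …` = the splitting datum of the CM dual pair `(U(diag dV), U(diag dW))` over `L ∕ L⁺`, `G₁ = U(diag dV ⊗ diag dW)`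
(`UnitaryDualPairThetaKernelCM`, docstring of `cmSplittingDatum`).  This leaf therefore offers the SAME pin over ONE hypothesis

  `hGRU : ∀ (L : Type) [Field L] [NumberField L] [NumberField.IsCMField L] {N M n : ℕ} (e : Fin N × Fin M ≃ Fin n)
            (dV : Fin N → L) (hdV : ∀ i, NumberField.IsCMField.complexConj L (dV i) = dV i) (hdV0 : ∀ i, dV i ≠ 0)
            (dW : Fin M → L) (hdW : ∀ i, NumberField.IsCMField.complexConj L (dW i) = dW i) (hdW0 : ∀ i, dW i ≠ 0),
            (cmSplittingDatum L e dV hdV hdV0 dW hdW hdW0).CompatibleSplitting`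

— Prop. 3.1.1 AT EVERY constructed CM dual-pair datum (every CM field `L`, every pair of non-degenerate diagonal hermitian frames; each
instance is one of the proposition's cases: `E ∕ F := L ∕ L⁺`, `(V, Φ) := (L^{N M}, δ · (diag dV ⊗ diag dW))`, object-match (c)(d) of the record's
module docstring; the `Mp` ∕ topology object-match (a)(b)(e) is the datum's, identical for every instance) — a closed Prop with NO data,
no reading and no numeric table in it (`SInstance.GRU` below is an `abbrev` for exactly this Π-type, a display convenience, not a record):

* §1 `SInstance.GRU` and the five DERIVED families `GRU.hGR ∕ hGR₀ ∕ hGR₁ ∕ hGR₂ ∕ hGR₃ hGRU` (theorems: instantiation only) — so every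
  pin-side theorem of record typed over `@hGR @hGR₀ @hGR₁ @hGR₂ @hGR₃` applies verbatim at `(@GRU.hGR hGRU) … (@GRU.hGR₃ hGRU)`;
* §2 **`SInstance.SROGT'CU hGRU μ hΔ₁ hΔ₂ hΔ₃`** := `SROGT'C` at the derived families (generic `μ`, the three guarded (J-μ) identities as
  inputs) and **`SInstance.SROGT'CJU hGRU μ`** := `SROGT'CJ` at the derived families (NO PROVE input: `μ♯♯ := ArchSideTerm.muSharp₂₃ μ`, the
  (J-μ) identities by the kernel theorems (K10) ∕ #1226) — pin inputs `hGRU` (CITE [GR91 3.1.1], once) and `μ` (DATA) ONLY; `SROGT'CU_eq` ∕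
  `SROGT'CJU_eq` ∕ `SROGT'CJU_eq_SROGT'C` (rfl), rows `hLF` ∕ 13 with no residual hypothesis beyond the pin data (`hLF_ROGT'CU`, `hT_ROGT'CU`, `hLF_ROGT'CJU`, `hT_ROGT'CJU`),
  `SROGT'CU_eq_archSideOfT'` ∕ `SROGT'CJU_eq_archSideOfT'` (under the OG guard the pin IS period-1's doubly twisted term, as #1229).

Intended consumer: an E-shaped child of glue-1's #398J2HHTCG with the five groups `hGR hGR₀ hGR₁ hGR₂ hGR₃` replaced by the one group `hGRU`
(«5 groups `hA hGRU μ hR hΘ`» = CITE 3 ([Arapura 2012 Cor. 15.4.6], [GR91 Prop. 3.1.1], [DM82 Thm 6.20]) + DATA `μ` + `hΘ`), proof = one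
application of #398J2HHTCG at `(@GRU.hGR hGRU) … (@GRU.hGR₃ hGRU)`.  Whether such a child is tabled, and how its one GR91 group is READ for the
headline, is the lead's ∕ model1's ∕ mc-ref's word, not this file's.
-/


set_option autoImplicit false

noncomputable section

open scoped Matrix Classical
open NumberField
open Literature.NumberTheory.Automorphic Literature.NumberTheory.Weil1964
open Literature.NumberTheory.GelbartRogawski1991 Literature.NumberTheory.GelbartRogawski1991.UnitaryDualPair
open HodgeCM.Adelic HodgeCM.PerL34
open Literature.Geometry.ComplexHyperbolic.BallModel (U21 x₀ stabilizerEquivK21)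
open Literature.NumberTheory.Automorphic.U21 (matA sclD)

namespace HodgeCM.Model.SInstance

open HodgeCM.Model.ArchSideTerm

/-! ## § 1 the uniform hypothesis shape and the five derived families -/

/-- **the UNIFORM [GelbartRogawski1991, Prop. 3.1.1] hypothesis shape**: the Vendored named fact `SplittingDatum.CompatibleSplitting`
(«The covering `π` splits over `G(𝐀)`. There exists a continuous section `s : G(𝐀) → Mp_𝐀(W)` such that `s(G(F))` is contained in
`i(Sp_F(W))`», p. 455 L1–3) AT EVERY constructed CM dual-pair datum `cmSplittingDatum L e dV … dW …` (`G₁ = U(diag dV ⊗ diag dW)` over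
`L ∕ L⁺`).  A display `abbrev` for a closed Π-type over the record — the binder TEXT used verbatim by every declaration below (which are
typed over that text, not over this name, so that a consumer's binder with the same text matches syntactically); NOT a new record,
nothing asserted. -/
abbrev GRU : Prop :=
  ∀ (L : Type) [Field L] [NumberField L] [NumberField.IsCMField L] {N M n : ℕ} (e : Fin N × Fin M ≃ Fin n)
    (dV : Fin N → L) (hdV : ∀ i, NumberField.IsCMField.complexConj L (dV i) = dV i) (hdV0 : ∀ i, dV i ≠ 0)
    (dW : Fin M → L) (hdW : ∀ i, NumberField.IsCMField.complexConj L (dW i) = dW i) (hdW0 : ∀ i, dW i ≠ 0),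
    (cmSplittingDatum L e dV hdV hdV0 dW hdW hdW0).CompatibleSplitting

-- the ONE uniform [GR91 Prop. 3.1.1] hypothesis `hGRU` (binder text = the body of `SInstance.GRU`, spelled out)
variable
  (hGRU : ∀ (L : Type) [Field L] [NumberField L] [NumberField.IsCMField L] {N M n : ℕ} (e : Fin N × Fin M ≃ Fin n)
    (dV : Fin N → L) (hdV : ∀ i, NumberField.IsCMField.complexConj L (dV i) = dV i) (hdV0 : ∀ i, dV i ≠ 0)
    (dW : Fin M → L) (hdW : ∀ i, NumberField.IsCMField.complexConj L (dW i) = dW i) (hdW0 : ∀ i, dW i ≠ 0),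
    (cmSplittingDatum L e dV hdV hdV0 dW hdW hdW0).CompatibleSplitting)

/-- a hypothesis of the spelled-out uniform shape IS a proof of `SInstance.GRU` and conversely (the same Π-type; `id`). -/
theorem GRU_iff :
    SInstance.GRU ↔
      ∀ (L : Type) [Field L] [NumberField L] [NumberField.IsCMField L] {N M n : ℕ} (e : Fin N × Fin M ≃ Fin n)
        (dV : Fin N → L) (hdV : ∀ i, NumberField.IsCMField.complexConj L (dV i) = dV i) (hdV0 : ∀ i, dV i ≠ 0)
        (dW : Fin M → L) (hdW : ∀ i, NumberField.IsCMField.complexConj L (dW i) = dW i) (hdW0 : ∀ i, dW i ≠ 0),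
        (cmSplittingDatum L e dV hdV hdV0 dW hdW hdW0).CompatibleSplitting :=
  Iff.rfl

namespace GRU

include hGRU

/-- the 3 × 2 block family `hGR` of record, DERIVED from the uniform hypothesis (instantiation at `finProdFinEquiv`, `frameD V`, `dW c.D`). -/
theorem hGR : ∀ {L : CMField} {ι₁ : L →+* ℂ} (V : HermSpace3 L ι₁) (c : SeesawCtx L),
    (cmSplittingDatum (L : Type) finProdFinEquiv (frameD V) (frameD_real V) (frameD_ne V) (dW c.D) (dW_real c.D)
      (dW_ne c.D)).CompatibleSplitting :=
  fun V c => hGRU _ finProdFinEquiv (frameD V) (frameD_real V) (frameD_ne V) (dW c.D) (dW_real c.D) (dW_ne c.D)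

/-- the first-plane line family `hGR₀` of record, DERIVED (instantiation at `e₁`, `frameD V`, `lineVec L (dW c.D 0)`). -/
theorem hGR₀ : ∀ {L : CMField} {ι₁ : L →+* ℂ} (V : HermSpace3 L ι₁) (c : SeesawCtx L),
    (cmSplittingDatum (L : Type) (e₁) (frameD V) (frameD_real V) (frameD_ne V) (lineVec (L : Type) (dW c.D 0))
      (fun _ => dW_real c.D 0) (fun _ => dW_ne c.D 0)).CompatibleSplitting :=
  fun V c => hGRU _ e₁ (frameD V) (frameD_real V) (frameD_ne V) (lineVec _ (dW c.D 0)) (fun _ => dW_real c.D 0) (fun _ => dW_ne c.D 0)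

/-- the first-plane line family `hGR₁` of record, DERIVED (instantiation at `e₁`, `frameD V`, `lineVec L (dW c.D 1)`). -/
theorem hGR₁ : ∀ {L : CMField} {ι₁ : L →+* ℂ} (V : HermSpace3 L ι₁) (c : SeesawCtx L),
    (cmSplittingDatum (L : Type) (e₁) (frameD V) (frameD_real V) (frameD_ne V) (lineVec (L : Type) (dW c.D 1))
      (fun _ => dW_real c.D 1) (fun _ => dW_ne c.D 1)).CompatibleSplitting :=
  fun V c => hGRU _ e₁ (frameD V) (frameD_real V) (frameD_ne V) (lineVec _ (dW c.D 1)) (fun _ => dW_real c.D 1) (fun _ => dW_ne c.D 1)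

/-- the second-plane line family `hGR₂` of record, DERIVED (instantiation at `e₁`, `frameD V`, `lineVec L (dW' c.D 0)`). -/
theorem hGR₂ : ∀ {L : CMField} {ι₁ : L →+* ℂ} (V : HermSpace3 L ι₁) (c : SeesawCtx L),
    (cmSplittingDatum (L : Type) (e₁) (frameD V) (frameD_real V) (frameD_ne V) (lineVec (L : Type) (dW' c.D 0))
      (fun _ => dW'_real c.D 0) (fun _ => dW'_ne c.D 0)).CompatibleSplitting :=
  fun V c => hGRU _ e₁ (frameD V) (frameD_real V) (frameD_ne V) (lineVec _ (dW' c.D 0)) (fun _ => dW'_real c.D 0) (fun _ => dW'_ne c.D 0)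

/-- the second-plane line family `hGR₃` of record, DERIVED (instantiation at `e₁`, `frameD V`, `lineVec L (dW' c.D 1)`). -/
theorem hGR₃ : ∀ {L : CMField} {ι₁ : L →+* ℂ} (V : HermSpace3 L ι₁) (c : SeesawCtx L),
    (cmSplittingDatum (L : Type) (e₁) (frameD V) (frameD_real V) (frameD_ne V) (lineVec (L : Type) (dW' c.D 1))
      (fun _ => dW'_real c.D 1) (fun _ => dW'_ne c.D 1)).CompatibleSplitting :=
  fun V c => hGRU _ e₁ (frameD V) (frameD_real V) (frameD_ne V) (lineVec _ (dW' c.D 1)) (fun _ => dW'_real c.D 1) (fun _ => dW'_ne c.D 1)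

end GRU

/-! ## § 2 the pins R2 over the uniform hypothesis: `SROGT'CU` (generic `μ`) and `SROGT'CJU` (no PROVE input) -/

variable (μ : ∀ {L : CMField}, SeesawCtx L → Fin 4 → NumberField.InfinitePlace (L : Type) → ℤ)

/-- **THE CONSTRUCTED ROW-5 PIN R2 OVER THE UNIFORM [GR91 3.1.1] HYPOTHESIS**, generic `μ`: `SROGT'C` (#1229) at the five derived
families `GRU.hGR … GRU.hGR₃ hGRU` — pin inputs `hGRU`, `μ` and the three guarded (J-μ) identities ONLY. -/
abbrev SROGT'CU
    (hΔ₁ : ∀ {L : CMField} {ι₁ : L →+* ℂ} (V : HermSpace3 L ι₁) (c : SeesawCtx L), ∀ hc : GOG V c,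
      slotTypeVec V c (GRU.hGR hGRU V c) (GRU.hGR₀ hGRU V c) (GRU.hGR₁ hGRU V c) (GRU.hGR₂ hGRU V c) (GRU.hGR₃ hGRU V c) (hG_GOG V c hc) 1 -
        slotTypeVec V c (GRU.hGR hGRU V c) (GRU.hGR₀ hGRU V c) (GRU.hGR₁ hGRU V c) (GRU.hGR₂ hGRU V c) (GRU.hGR₃ hGRU V c) (hG_GOG V c hc) 0 =
          μ c 1 - μ c 0)
    (hΔ₂ : ∀ {L : CMField} {ι₁ : L →+* ℂ} (V : HermSpace3 L ι₁) (c : SeesawCtx L), ∀ hc : GOG V c,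
      slotTypeVec V c (GRU.hGR hGRU V c) (GRU.hGR₀ hGRU V c) (GRU.hGR₁ hGRU V c) (GRU.hGR₂ hGRU V c) (GRU.hGR₃ hGRU V c) (hG_GOG V c hc) 2 -
        slotTypeVec V c (GRU.hGR hGRU V c) (GRU.hGR₀ hGRU V c) (GRU.hGR₁ hGRU V c) (GRU.hGR₂ hGRU V c) (GRU.hGR₃ hGRU V c) (hG_GOG V c hc) 0 =
          μ c 2 - μ c 0)
    (hΔ₃ : ∀ {L : CMField} {ι₁ : L →+* ℂ} (V : HermSpace3 L ι₁) (c : SeesawCtx L), ∀ hc : GOG V c,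
      slotTypeVec V c (GRU.hGR hGRU V c) (GRU.hGR₀ hGRU V c) (GRU.hGR₁ hGRU V c) (GRU.hGR₂ hGRU V c) (GRU.hGR₃ hGRU V c) (hG_GOG V c hc) 3 -
        slotTypeVec V c (GRU.hGR hGRU V c) (GRU.hGR₀ hGRU V c) (GRU.hGR₁ hGRU V c) (GRU.hGR₂ hGRU V c) (GRU.hGR₃ hGRU V c) (hG_GOG V c hc) 0 =
          μ c 3 - μ c 0) :
    ∀ {L : CMField} {ι₁ : L →+* ℂ} (V : HermSpace3 L ι₁) (c : SeesawCtx L), ThetaAdelicSide V c :=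
  SROGT'C (@GRU.hGR hGRU) (@GRU.hGR₀ hGRU) (@GRU.hGR₁ hGRU) (@GRU.hGR₂ hGRU) (@GRU.hGR₃ hGRU) @μ hΔ₁ hΔ₂ hΔ₃

/-- `SROGT'CU` is `SROGT'C` at the five derived families (definitional). -/
theorem SROGT'CU_eq (hΔ₁ hΔ₂ hΔ₃) {L : CMField} {ι₁ : L →+* ℂ} (V : HermSpace3 L ι₁) (c : SeesawCtx L) :
    SROGT'CU hGRU @μ hΔ₁ hΔ₂ hΔ₃ V c =
      SROGT'C (@GRU.hGR hGRU) (@GRU.hGR₀ hGRU) (@GRU.hGR₁ hGRU) (@GRU.hGR₂ hGRU) (@GRU.hGR₃ hGRU) @μ hΔ₁ hΔ₂ hΔ₃ V c :=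
  rfl

/-- **row 13 `hT` at the uniform-hypothesis pin R2 (generic `μ`): no residual hypothesis beyond the pin data `hGRU`, `μ`, `hΔ₁–₃`.** -/
theorem hT_ROGT'CU (hΔ₁ hΔ₂ hΔ₃) : ∀ {L : CMField} {ι₁ : L →+* ℂ} (V : HermSpace3 L ι₁) (c : SeesawCtx L) (k : Fin 4) (N : ℕ),
    ((SROGT'CU hGRU @μ hΔ₁ hΔ₂ hΔ₃ V c).P k).IsThetaArchContinuous N :=
  hT_ROGT'C _ _ _ _ _ _ hΔ₁ hΔ₂ hΔ₃

/-- `hLF` at the uniform-hypothesis pin R2 (generic `μ`): no residual hypothesis beyond the pin data. -/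
theorem hLF_ROGT'CU (hΔ₁ hΔ₂ hΔ₃) : ∀ {L : CMField} {ι₁ : L →+* ℂ} (V : HermSpace3 L ι₁) (c : SeesawCtx L) (k : Fin 4),
    ((SROGT'CU hGRU @μ hΔ₁ hΔ₂ hΔ₃ V c).P k).IsLFAction :=
  hLF_ROGT'C _ _ _ _ _ _ hΔ₁ hΔ₂ hΔ₃

/-- **under the OG guard the uniform-hypothesis pin R2 IS period-1's doubly twisted term** `archSideOfT'` at the derived families,
`η := EtaChi.η χVR (χWR μ)`, `νR`, `ν'R`, `ART'` (#1229 `SROGT'C_eq_archSideOfT'` at the derived families). -/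
theorem SROGT'CU_eq_archSideOfT' (hΔ₁ hΔ₂ hΔ₃) {L : CMField} {ι₁ : L →+* ℂ} (V : HermSpace3 L ι₁) (c : SeesawCtx L) (hc : GOG V c) :
    SROGT'CU hGRU @μ hΔ₁ hΔ₂ hΔ₃ V c =
      archSideOfT' V c (GRU.hGR hGRU V c) (GRU.hGR₀ hGRU V c) (GRU.hGR₁ hGRU V c) (GRU.hGR₂ hGRU V c) (GRU.hGR₃ hGRU V c)
        (EtaChi.η (@χVR (@GRU.hGR hGRU) (@GRU.hGR₀ hGRU) (@GRU.hGR₁ hGRU)) (@χWR (@GRU.hGR hGRU) (@GRU.hGR₀ hGRU) (@GRU.hGR₁ hGRU) @μ) V c)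
        (EtaChi.hη (@χVR (@GRU.hGR hGRU) (@GRU.hGR₀ hGRU) (@GRU.hGR₁ hGRU)) (@χWR (@GRU.hGR hGRU) (@GRU.hGR₀ hGRU) (@GRU.hGR₁ hGRU) @μ) V c)
        (EtaChi.hηc (@χVR (@GRU.hGR hGRU) (@GRU.hGR₀ hGRU) (@GRU.hGR₁ hGRU)) (@χWR (@GRU.hGR hGRU) (@GRU.hGR₀ hGRU) (@GRU.hGR₁ hGRU) @μ) V c)
        (νR (@GRU.hGR₁ hGRU) V c) (hνR (@GRU.hGR₁ hGRU) V c) (hνcR (@GRU.hGR₁ hGRU) V c)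
        (ν'R (@GRU.hGR₃ hGRU) V c) (hν'R (@GRU.hGR₃ hGRU) V c) (hν'cR (@GRU.hGR₃ hGRU) V c) (hG_GOG V c hc)
        (ART' @GOG @hG_GOG (@GRU.hGR hGRU) @(@χVR (@GRU.hGR hGRU) (@GRU.hGR₀ hGRU) (@GRU.hGR₁ hGRU)) @(@νR (@GRU.hGR₁ hGRU))
          @(@ν'R (@GRU.hGR₃ hGRU)) (@GRU.hGR₀ hGRU) (@GRU.hGR₁ hGRU) (@GRU.hGR₂ hGRU) (@GRU.hGR₃ hGRU) @μ @hpos_GOG @hΔ₁ @hΔ₂ @hΔ₃ V c hc) :=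
  SROGT'C_eq_archSideOfT' _ _ _ _ _ _ hΔ₁ hΔ₂ hΔ₃ V c hc

/-- **PIN R2 OVER THE UNIFORM [GR91 3.1.1] HYPOTHESIS WITH NO PROVE INPUT**: `SROGT'CJ` (#1229 § 2) at the five derived families —
`μ♯♯ := ArchSideTerm.muSharp₂₃ μ`, the three (J-μ) identities by the kernel theorems `hΔ₁_GOG_muSharp₂₃` (K10) and
`hΔ₂ ∕ hΔ₃_GOG_muSharp₂₃_holds` (#1226); inputs `hGRU` (CITE [GR91 3.1.1], ONE group) and `μ` (DATA) ONLY. -/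
abbrev SROGT'CJU : ∀ {L : CMField} {ι₁ : L →+* ℂ} (V : HermSpace3 L ι₁) (c : SeesawCtx L), ThetaAdelicSide V c :=
  SROGT'CJ (@GRU.hGR hGRU) (@GRU.hGR₀ hGRU) (@GRU.hGR₁ hGRU) (@GRU.hGR₂ hGRU) (@GRU.hGR₃ hGRU) @μ

/-- `SROGT'CJU` IS `SROGT'CJ` at the five derived families (definitional). -/
theorem SROGT'CJU_eq {L : CMField} {ι₁ : L →+* ℂ} (V : HermSpace3 L ι₁) (c : SeesawCtx L) :
    SROGT'CJU hGRU @μ V c = SROGT'CJ (@GRU.hGR hGRU) (@GRU.hGR₀ hGRU) (@GRU.hGR₁ hGRU) (@GRU.hGR₂ hGRU) (@GRU.hGR₃ hGRU) @μ V c :=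
  rfl

/-- `SROGT'CJU` IS `SROGT'C` at the derived families, `μ♯♯` and the three (J-μ) theorems spelled through (K10)'s socket `(hSV_holds …)` —
the spelling of glue-1's E-children #398J2HHTC ∕ #398J2HHTCG (definitional). -/
theorem SROGT'CJU_eq_SROGT'C {L : CMField} {ι₁ : L →+* ℂ} (V : HermSpace3 L ι₁) (c : SeesawCtx L) :
    SROGT'CJU hGRU @μ V c =
      SROGT'C (@GRU.hGR hGRU) (@GRU.hGR₀ hGRU) (@GRU.hGR₁ hGRU) (@GRU.hGR₂ hGRU) (@GRU.hGR₃ hGRU) (ArchSideTerm.muSharp₂₃ @μ)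
        (ArchSideTerm.hΔ₁_GOG_muSharp₂₃ (@GRU.hGR hGRU) (@GRU.hGR₀ hGRU) (@GRU.hGR₁ hGRU) (@GRU.hGR₂ hGRU) (@GRU.hGR₃ hGRU) @μ)
        (ArchSideTerm.hΔ₂_GOG_muSharp₂₃ (@GRU.hGR hGRU) (@GRU.hGR₀ hGRU) (@GRU.hGR₁ hGRU) (@GRU.hGR₂ hGRU) (@GRU.hGR₃ hGRU) @μ
          (ArchSideTerm.hSV_holds (@GRU.hGR hGRU)))
        (ArchSideTerm.hΔ₃_GOG_muSharp₂₃ (@GRU.hGR hGRU) (@GRU.hGR₀ hGRU) (@GRU.hGR₁ hGRU) (@GRU.hGR₂ hGRU) (@GRU.hGR₃ hGRU) @μ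
          (ArchSideTerm.hSV_holds (@GRU.hGR hGRU))) V c :=
  rfl

/-- **row 13 `hT` at the uniform-hypothesis pin R2 with no PROVE input: no residual hypothesis beyond the pin data `hGRU`, `μ`.** -/
theorem hT_ROGT'CJU : ∀ {L : CMField} {ι₁ : L →+* ℂ} (V : HermSpace3 L ι₁) (c : SeesawCtx L) (k : Fin 4) (N : ℕ),
    ((SROGT'CJU hGRU @μ V c).P k).IsThetaArchContinuous N :=
  hT_ROGT'CJ _ _ _ _ _ _

/-- `hLF` at the uniform-hypothesis pin R2 with no PROVE input: no residual hypothesis beyond the pin data. -/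
theorem hLF_ROGT'CJU : ∀ {L : CMField} {ι₁ : L →+* ℂ} (V : HermSpace3 L ι₁) (c : SeesawCtx L) (k : Fin 4),
    ((SROGT'CJU hGRU @μ V c).P k).IsLFAction :=
  hLF_ROGT'CJ _ _ _ _ _ _

/-- under the OG guard the uniform-hypothesis pin R2 with no PROVE input IS period-1's doubly twisted term at the derived families,
`η := EtaChi.η χVR (χWR μ♯♯)`, `νR`, `ν'R`, `ART'` at `μ♯♯` (#1229 `SROGT'CJ_eq_archSideOfT'` at the derived families). -/
theorem SROGT'CJU_eq_archSideOfT' {L : CMField} {ι₁ : L →+* ℂ} (V : HermSpace3 L ι₁) (c : SeesawCtx L) (hc : GOG V c) :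
    SROGT'CJU hGRU @μ V c =
      archSideOfT' V c (GRU.hGR hGRU V c) (GRU.hGR₀ hGRU V c) (GRU.hGR₁ hGRU V c) (GRU.hGR₂ hGRU V c) (GRU.hGR₃ hGRU V c)
        (EtaChi.η (@χVR (@GRU.hGR hGRU) (@GRU.hGR₀ hGRU) (@GRU.hGR₁ hGRU))
          (@χWR (@GRU.hGR hGRU) (@GRU.hGR₀ hGRU) (@GRU.hGR₁ hGRU) (ArchSideTerm.muSharp₂₃ @μ)) V c)
        (EtaChi.hη (@χVR (@GRU.hGR hGRU) (@GRU.hGR₀ hGRU) (@GRU.hGR₁ hGRU))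
          (@χWR (@GRU.hGR hGRU) (@GRU.hGR₀ hGRU) (@GRU.hGR₁ hGRU) (ArchSideTerm.muSharp₂₃ @μ)) V c)
        (EtaChi.hηc (@χVR (@GRU.hGR hGRU) (@GRU.hGR₀ hGRU) (@GRU.hGR₁ hGRU))
          (@χWR (@GRU.hGR hGRU) (@GRU.hGR₀ hGRU) (@GRU.hGR₁ hGRU) (ArchSideTerm.muSharp₂₃ @μ)) V c)
        (νR (@GRU.hGR₁ hGRU) V c) (hνR (@GRU.hGR₁ hGRU) V c) (hνcR (@GRU.hGR₁ hGRU) V c)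
        (ν'R (@GRU.hGR₃ hGRU) V c) (hν'R (@GRU.hGR₃ hGRU) V c) (hν'cR (@GRU.hGR₃ hGRU) V c) (hG_GOG V c hc)
        (ART' @GOG @hG_GOG (@GRU.hGR hGRU) @(@χVR (@GRU.hGR hGRU) (@GRU.hGR₀ hGRU) (@GRU.hGR₁ hGRU)) @(@νR (@GRU.hGR₁ hGRU))
          @(@ν'R (@GRU.hGR₃ hGRU)) (@GRU.hGR₀ hGRU) (@GRU.hGR₁ hGRU) (@GRU.hGR₂ hGRU) (@GRU.hGR₃ hGRU) (ArchSideTerm.muSharp₂₃ @μ) @hpos_GOG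
          (ArchSideTerm.hΔ₁_GOG_muSharp₂₃ (@GRU.hGR hGRU) (@GRU.hGR₀ hGRU) (@GRU.hGR₁ hGRU) (@GRU.hGR₂ hGRU) (@GRU.hGR₃ hGRU) @μ)
          (ArchSideTerm.hΔ₂_GOG_muSharp₂₃_holds (@GRU.hGR hGRU) (@GRU.hGR₀ hGRU) (@GRU.hGR₁ hGRU) (@GRU.hGR₂ hGRU) (@GRU.hGR₃ hGRU) @μ)
          (ArchSideTerm.hΔ₃_GOG_muSharp₂₃_holds (@GRU.hGR hGRU) (@GRU.hGR₀ hGRU) (@GRU.hGR₁ hGRU) (@GRU.hGR₂ hGRU) (@GRU.hGR₃ hGRU) @μ)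
          V c hc) :=
  SROGT'CJ_eq_archSideOfT' _ _ _ _ _ _ V c hc

end HodgeCM.Model.SInstance

end
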